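import Mathlib

/-!
# Ball values of the augmented generic matrix `[1 | Z]`

For the generic `n × m'` matrix `Z = (X (i, j))` over `MvPolynomial (Fin n × Fin m') ℂ` and the augmented
matrix `[1 | Z] := (Matrix.fromCols 1 Z).submatrix id finSumFinEquiv.symm` (columns indexed by
`Fin (n + m')`: identity columns `Fin.castAdd m' a`, `Z`-columns `Fin.natAdd n j`):

* the maximal minor on the identity tuple `Fin.castAdd m'` is `det 1 = 1`;
* the maximal minor on the tuple `Function.update (Fin.castAdd m') i (Fin.natAdd n j)` (identity column `i`
  traded for `Z`-column `j`) is `det ((1 : Matrix).updateCol i (Z · j)) = Z i j = X (i, j)` exactly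
  (Cramer's rule on the identity matrix, `Matrix.cramer_one`).

[folklore]
-/

set_option linter.dupNamespace false

namespace Summit.MatrixMultiplication.MatrixMultiplication.Theorems.CondensationSound

/-- Restricting the columns of `[A₁ | A₂]` (reindexed along `finSumFinEquiv`) to the left tuple
`Fin.castAdd n₂` recovers the left block `A₁`. [folklore] -/
theorem fromCols_submatrix_finSumFinEquiv_symm_castAdd {m : Type*} {n₁ n₂ : ℕ} {R : Type*}
    (A₁ : Matrix m (Fin n₁) R) (A₂ : Matrix m (Fin n₂) R) :
    ((Matrix.fromCols A₁ A₂).submatrix id ⇑finSumFinEquiv.symm).submatrix id (Fin.castAdd n₂) = A₁ := by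
  ext a b
  simp [Matrix.submatrix_apply]

/-- Trading the left column `i` of the tuple `Fin.castAdd n₂` for the right-block column `Fin.natAdd n₁ j`
turns the corresponding column restriction of `[A₁ | A₂]` into `A₁` with column `i` replaced by column `j`
of `A₂`. [folklore] -/
theorem fromCols_submatrix_finSumFinEquiv_symm_update_castAdd {m : Type*} {n₁ n₂ : ℕ} {R : Type*}
    (A₁ : Matrix m (Fin n₁) R) (A₂ : Matrix m (Fin n₂) R) (i : Fin n₁) (j : Fin n₂) :
    ((Matrix.fromCols A₁ A₂).submatrix id ⇑finSumFinEquiv.symm).submatrix id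
        (Function.update (Fin.castAdd n₂) i (Fin.natAdd n₁ j)) = A₁.updateCol i fun r => A₂ r j := by
  ext r b
  by_cases hb : b = i
  · subst hb
    simp [Matrix.submatrix_apply]
  · simp [Matrix.submatrix_apply, Function.update_of_ne hb, Matrix.updateCol_ne hb]

-- adapted from Literature/LinearAlgebra/QuadraticForm/DefiniteUnimodularPolynomialLattice.lean
-- (`det_updateCol_one`)
/-- Cramer's rule on the identity matrix: replacing column `i` of `1` by the vector `z` gives a matrix of
determinant `z i`. [folklore] -/
theorem det_one_updateCol_ballValues {n : Type*} [DecidableEq n] [Fintype n] {R : Type*} [CommRing R]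
    (i : n) (z : n → R) : ((1 : Matrix n n R).updateCol i z).det = z i := by
  rw [← Matrix.cramer_apply, Matrix.cramer_one]
  rfl

/-- **Ball values of `[1 | Z]`**: on the identity tuple `Fin.castAdd m'` the maximal minor of the augmented
generic matrix is `det 1 = 1`, and on the tuple `Fin.castAdd m' [i ↦ Fin.natAdd n j]` it is
`det ((1 : Matrix).updateCol i (Z · j)) = Z i j = X (i, j)` exactly. [folklore] -/
theorem stub_ballValues :
    ∀ (n m' : ℕ),
      (((Matrix.fromCols (1 : Matrix (Fin n) (Fin n) (MvPolynomial (Fin n × Fin m') ℂ))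
          (Matrix.of fun i j => MvPolynomial.X (i, j))).submatrix id ⇑finSumFinEquiv.symm).submatrix
            id (Fin.castAdd m')).det = 1 ∧
      ∀ (i : Fin n) (j : Fin m'),
        (((Matrix.fromCols (1 : Matrix (Fin n) (Fin n) (MvPolynomial (Fin n × Fin m') ℂ))
          (Matrix.of fun i j => MvPolynomial.X (i, j))).submatrix id ⇑finSumFinEquiv.symm).submatrix
            id (Function.update (Fin.castAdd m') i (Fin.natAdd n j))).det = MvPolynomial.X (i, j) := by
  intro n m'
  refine ⟨?_, fun i j => ?_⟩
  · rw [fromCols_submatrix_finSumFinEquiv_symm_castAdd, Matrix.det_one]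
  · rw [fromCols_submatrix_finSumFinEquiv_symm_update_castAdd, det_one_updateCol_ballValues,
      Matrix.of_apply]

end Summit.MatrixMultiplication.MatrixMultiplication.Theorems.CondensationSound
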